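import Mathlib.Data.Nat.Choose.Basic
import Mathlib.Algebra.BigOperators.Intervals
import Mathlib.Algebra.Order.BigOperators.Group.Finset
import Mathlib.Tactic
import Summits.CriticalPhenomena.PercolationContinuityZ3.Theorems.PercNearOneGluingNoHeavyLowerTailUZeroBase
import HarnessLib

/-!
# CONJECTURE U without buffer (`L = 0`): two windowed blocks (Proposition Z)

Support file for the Sahi / Conjecture-P programme of route `PercNearOneGluingNoHeavy`
(`--supports stmt-CriticalPhenomena-4575`, prover prim-l12-p5 gen 28; proof note
`prim-l12-p5/U-PROOF-g28.md` §4, Proposition Z).  No definitions, no named facts, no sorries.  Notation of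
`…UZeroBase`: blocks of `M₁` and `n` coins, `K` heads, `2K + j = M₁ + n`, index `h` = heads in the `n`-block,
`P(h) = C(n,h) C(M₁,K-h)`, `f(h) = κ₀ - (2h-n)(2h-n+j)`.

* `propZ` (**Proposition Z**) : for every pair of centred windows (`i` on `h`, `i₁` on `x₁ = K-h`):
  `0 ≤ ∑_h [i ≤ h ≤ n-i] [i₁ ≤ K-h ≤ M₁-i₁] P(h) f(h)`.  Proof: the doubly-windowed index set `W` is an interval,
  `f ≥ 0` between the two window centres `(n-j)/2 ≤ n/2`, and negativity of `f` propagates outward from either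
  side (three-point identity); four cases according to the sides on which `W` has negative terms, each reduced
  to `UZeroBase.ob_h`, `UZeroBase.ob_x` or the total by discarding only nonnegative terms of `W` (or adding only
  nonpositive terms outside `W`).
-/

namespace Summit.CriticalPhenomena.PercolationContinuityZ3.Theorems

namespace UZero

open Finset UZeroBase

/-- **Proposition Z** (CONJECTURE U at `L = 0`, both blocks windowed).  For `2K + j = M₁ + n` (`M₁, n ≥ 1`),
`κ₀ ≥ 0` with `κ₀ N(N-1) ≥ M₁ n (N-j²)` (`N = M₁ + n`), and all `i, i₁`:
`0 ≤ ∑_h [i ≤ h ≤ n-i] [h ≤ K, i₁ ≤ K-h ≤ M₁-i₁] C(n,h) C(M₁,K-h) (κ₀ - (2h-n)(2h-n+j))`. -/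
theorem propZ (M₁ n K j : ℕ) (hK : 2 * K + j = M₁ + n) (hM : 1 ≤ M₁) (hn : 1 ≤ n) (κ₀ : ℝ) (hκ₀ : 0 ≤ κ₀)
    (hκ₀' : (M₁ : ℝ) * n * (((M₁ : ℝ) + n) - (j : ℝ) ^ 2) ≤ κ₀ * (((M₁ : ℝ) + n) * (((M₁ : ℝ) + n) - 1)))
    (i₁ i : ℕ) :
    0 ≤ ∑ h ∈ range (n + 1), (if i ≤ h ∧ h ≤ n - i then
      (if h ≤ K ∧ i₁ ≤ K - h ∧ K - h ≤ M₁ - i₁ then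
        (n.choose h : ℝ) * (M₁.choose (K - h) : ℝ) * (κ₀ - (2 * (h : ℝ) - n) * (2 * (h : ℝ) - n + j)) else 0)
      else 0) := by
  classical
  -- notation: P h, f h, and the doubly-windowed predicate W
  set f : ℕ → ℝ := fun h => κ₀ - (2 * (h : ℝ) - n) * (2 * (h : ℝ) - n + j) with hf
  set P : ℕ → ℝ := fun h => (n.choose h : ℝ) * (M₁.choose (K - h) : ℝ) with hP
  have hPnn : ∀ h, 0 ≤ P h := fun h => by
    show 0 ≤ (n.choose h : ℝ) * (M₁.choose (K - h) : ℝ)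
    positivity
  set W : ℕ → Prop := fun h => i ≤ h ∧ h ≤ n - i ∧ (h ≤ K ∧ i₁ ≤ K - h ∧ K - h ≤ M₁ - i₁) with hW
  have eW : ∀ h ∈ range (n + 1), (if i ≤ h ∧ h ≤ n - i then
      (if h ≤ K ∧ i₁ ≤ K - h ∧ K - h ≤ M₁ - i₁ then
        (n.choose h : ℝ) * (M₁.choose (K - h) : ℝ) * (κ₀ - (2 * (h : ℝ) - n) * (2 * (h : ℝ) - n + j)) else 0)
      else 0) = (if W h then P h * f h else 0) := by
    intro h _
    by_cases h1 : i ≤ h ∧ h ≤ n - i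
    · rw [if_pos h1]
      by_cases h2 : h ≤ K ∧ i₁ ≤ K - h ∧ K - h ≤ M₁ - i₁
      · have hw : W h := ⟨h1.1, h1.2, h2⟩
        rw [if_pos h2, if_pos hw]
      · have hw : ¬ W h := fun hc => h2 hc.2.2
        rw [if_neg h2, if_neg hw]
    · have hw : ¬ W h := fun hc => h1 ⟨hc.1, hc.2.1⟩
      rw [if_neg h1, if_neg hw]
  rw [sum_congr rfl eW]
  -- sign structure of f
  have f_mid : ∀ h : ℕ, n ≤ 2 * h + j → 2 * h ≤ n → 0 ≤ f h := by
    intro h h1 h2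
    show 0 ≤ κ₀ - (2 * (h : ℝ) - n) * (2 * (h : ℝ) - n + j)
    have a1 : 2 * (h : ℝ) - n ≤ 0 := by
      have : ((2 * h : ℕ) : ℝ) ≤ n := by exact_mod_cast h2
      push_cast at this; linarith
    have a2 : 0 ≤ 2 * (h : ℝ) - n + j := by
      have : ((n : ℕ) : ℝ) ≤ ((2 * h + j : ℕ) : ℝ) := by exact_mod_cast h1
      push_cast at this; linarith
    nlinarith [mul_nonneg (neg_nonneg.mpr a1) a2]
  have f_side : ∀ h : ℕ, f h < 0 → 2 * h + j < n ∨ n < 2 * h := by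
    intro h hh
    by_contra hc
    push Not at hc
    have := f_mid h (by omega) (by omega)
    linarith
  -- left negativity propagates left, right negativity propagates right (three-point identity with a centre)
  have f_left : ∀ h₀ h : ℕ, f h₀ < 0 → 2 * h₀ + j < n → h ≤ h₀ → f h < 0 := by
    intro h₀ h hneg hside hle
    rcases Nat.eq_or_lt_of_le hle with heq | hlt
    · rw [heq]; exact hneg
    · have hid := quad_three_point κ₀ n j (h : ℝ) (h₀ : ℝ) (((n : ℝ) - j) / 2)
      have hr : κ₀ - (2 * (((n : ℝ) - j) / 2) - n) * (2 * (((n : ℝ) - j) / 2) - n + j) = κ₀ := by ring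
      rw [hr] at hid
      have hq0 : (h : ℝ) < h₀ := by exact_mod_cast hlt
      have hr0 : (h₀ : ℝ) < ((n : ℝ) - j) / 2 := by
        have : ((2 * h₀ + j : ℕ) : ℝ) < n := by exact_mod_cast hside
        push_cast at this; linarith
      have hneg' : κ₀ - (2 * (h₀ : ℝ) - n) * (2 * (h₀ : ℝ) - n + j) < 0 := hneg
      show κ₀ - (2 * (h : ℝ) - n) * (2 * (h : ℝ) - n + j) < 0
      by_contra hc
      push Not at hc
      have h1 : 0 ≤ (((n : ℝ) - j) / 2 - h₀) * (κ₀ - (2 * (h : ℝ) - n) * (2 * (h : ℝ) - n + j)) :=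
        mul_nonneg (by linarith) hc
      have h2 : 0 ≤ ((h₀ : ℝ) - h) * κ₀ := mul_nonneg (by linarith) hκ₀
      have h3 : 0 ≤ 4 * ((h₀ : ℝ) - h) * (((n : ℝ) - j) / 2 - h₀) * (((n : ℝ) - j) / 2 - h) := by
        have := mul_nonneg (mul_nonneg (by linarith : (0:ℝ) ≤ (h₀ : ℝ) - h)
          (by linarith : (0:ℝ) ≤ ((n : ℝ) - j) / 2 - h₀)) (by linarith : (0:ℝ) ≤ ((n : ℝ) - j) / 2 - h)
        linarith
      have h4 : (((n : ℝ) - j) / 2 - h) * (κ₀ - (2 * (h₀ : ℝ) - n) * (2 * (h₀ : ℝ) - n + j)) < 0 :=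
        mul_neg_of_pos_of_neg (by linarith) hneg'
      linarith
  have f_right : ∀ h₀ h : ℕ, f h₀ < 0 → n < 2 * h₀ → h₀ ≤ h → f h < 0 := by
    intro h₀ h hneg hside hle
    rcases Nat.eq_or_lt_of_le hle with heq | hlt
    · rw [← heq]; exact hneg
    · have hid := quad_three_point κ₀ n j ((n : ℝ) / 2) (h₀ : ℝ) (h : ℝ)
      have hp : κ₀ - (2 * ((n : ℝ) / 2) - n) * (2 * ((n : ℝ) / 2) - n + j) = κ₀ := by ring
      rw [hp] at hid
      have hq0 : (h₀ : ℝ) < h := by exact_mod_cast hlt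
      have hp0 : (n : ℝ) / 2 < h₀ := by
        have : ((n : ℕ) : ℝ) < ((2 * h₀ : ℕ) : ℝ) := by exact_mod_cast hside
        push_cast at this; linarith
      have hneg' : κ₀ - (2 * (h₀ : ℝ) - n) * (2 * (h₀ : ℝ) - n + j) < 0 := hneg
      show κ₀ - (2 * (h : ℝ) - n) * (2 * (h : ℝ) - n + j) < 0
      by_contra hc
      push Not at hc
      have h1 : 0 ≤ ((h₀ : ℝ) - (n : ℝ) / 2) * (κ₀ - (2 * (h : ℝ) - n) * (2 * (h : ℝ) - n + j)) :=
        mul_nonneg (by linarith) hc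
      have h2 : 0 ≤ ((h : ℝ) - h₀) * κ₀ := mul_nonneg (by linarith) hκ₀
      have h3 : 0 ≤ 4 * ((h₀ : ℝ) - (n : ℝ) / 2) * ((h : ℝ) - h₀) * ((h : ℝ) - (n : ℝ) / 2) := by
        have := mul_nonneg (mul_nonneg (by linarith : (0:ℝ) ≤ (h₀ : ℝ) - (n : ℝ) / 2)
          (by linarith : (0:ℝ) ≤ (h : ℝ) - h₀)) (by linarith : (0:ℝ) ≤ (h : ℝ) - (n : ℝ) / 2)
        linarith
      have h4 : ((h : ℝ) - (n : ℝ) / 2) * (κ₀ - (2 * (h₀ : ℝ) - n) * (2 * (h₀ : ℝ) - n + j)) < 0 :=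
        mul_neg_of_pos_of_neg (by linarith) hneg'
      linarith
  -- W is an interval
  have W_int : ∀ h₁ h₂ h, W h₁ → W h₂ → h₁ ≤ h → h ≤ h₂ → W h := by
    intro h₁ h₂ h w1 w2 hl hu
    obtain ⟨a1, a2, a3, a4, a5⟩ := w1
    obtain ⟨b1, b2, b3, b4, b5⟩ := w2
    exact ⟨by omega, by omega, by omega, by omega, by omega⟩
  -- generic comparison of window sums
  have mono : ∀ (A B : ℕ → Prop) {_ : DecidablePred A} {_ : DecidablePred B},
      (∀ h, B h → A h) → (∀ h, h < n + 1 → A h → ¬ B h → 0 ≤ f h) →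
      ∑ h ∈ range (n + 1), (if B h then P h * f h else 0) ≤ ∑ h ∈ range (n + 1), (if A h then P h * f h else 0) := by
    intro A B _ _ hBA hpos
    apply sum_le_sum
    intro h hh
    by_cases hb : B h
    · rw [if_pos hb, if_pos (hBA h hb)]
    · rw [if_neg hb]
      by_cases ha : A h
      · rw [if_pos ha]
        exact mul_nonneg (hPnn h) (hpos h (mem_range.mp hh) ha hb)
      · rw [if_neg ha]
  have mono' : ∀ (A B : ℕ → Prop) {_ : DecidablePred A} {_ : DecidablePred B},
      (∀ h, B h → A h) → (∀ h, h < n + 1 → A h → ¬ B h → f h ≤ 0) →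
      ∑ h ∈ range (n + 1), (if A h then P h * f h else 0) ≤ ∑ h ∈ range (n + 1), (if B h then P h * f h else 0) := by
    intro A B _ _ hBA hneg
    apply sum_le_sum
    intro h hh
    by_cases hb : B h
    · rw [if_pos hb, if_pos (hBA h hb)]
    · rw [if_neg hb]
      by_cases ha : A h
      · rw [if_pos ha]
        exact mul_nonpos_of_nonneg_of_nonpos (hPnn h) (hneg h (mem_range.mp hh) ha hb)
      · rw [if_neg ha]
  -- the three base sums
  have hobh := ob_h M₁ n K j hK hM hn κ₀ hκ₀ hκ₀'
  have hobx := ob_x M₁ n K j hK hM hn κ₀ hκ₀ hκ₀'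
  have htot : 0 ≤ ∑ h ∈ range (n + 1), (if h ≤ K then P h * f h else 0) := by
    have h0 := hobh 0
    have e : ∀ h ∈ range (n + 1), (if 0 ≤ h ∧ h ≤ n - 0 ∧ h ≤ K then
        (n.choose h : ℝ) * (M₁.choose (K - h) : ℝ) * (κ₀ - (2 * (h : ℝ) - n) * (2 * (h : ℝ) - n + j)) else 0) =
        (if h ≤ K then P h * f h else 0) := by
      intro h hh
      have := mem_range.mp hh
      by_cases hc : h ≤ K
      · rw [if_pos ⟨Nat.zero_le h, by omega, hc⟩, if_pos hc]
      · rw [if_neg (fun hc' => hc hc'.2.2), if_neg hc]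
    rw [sum_congr rfl e] at h0
    exact h0
  -- case analysis on where the negative W-terms are
  by_cases hexL : ∃ h, h < n + 1 ∧ W h ∧ f h < 0 ∧ 2 * h + j < n
  · by_cases hexR : ∃ h, h < n + 1 ∧ W h ∧ f h < 0 ∧ n < 2 * h
    · -- negatives on both sides: every present term outside W is negative; compare with the total
      obtain ⟨hL, _, hWL, hfL, hsL⟩ := hexL
      obtain ⟨hR, _, hWR, hfR, hsR⟩ := hexR
      refine le_trans htot (mono' (fun h => h ≤ K) W (fun h w => w.2.2.1) ?_)
      intro h _ _ hnW
      rcases lt_or_ge h hL with hlt | hge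
      · exact (f_left hL h hfL hsL hlt.le).le
      · rcases le_or_gt h hR with hle | hgt
        · exact absurd (W_int hL hR h hWL hWR hge hle) hnW
        · exact (f_right hR h hfR hsR hgt.le).le
    · -- negatives only on the left: a := the least negative element of W; compare with the x₁-window
      -- [a, n-j-a] in h, i.e. the centred window of index i₁' = a + M₁ - K on the M₁-block
      have hex : ∃ h, h < n + 1 ∧ W h ∧ f h < 0 := by
        obtain ⟨h, h1, h2, h3, _⟩ := hexL
        exact ⟨h, h1, h2, h3⟩
      obtain ⟨han, hWa, hfa⟩ := Nat.find_spec hex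
      have hmin : ∀ h, h < Nat.find hex → ¬ (h < n + 1 ∧ W h ∧ f h < 0) := fun h hh => Nat.find_min hex hh
      set a := Nat.find hex with ha
      have hsa : 2 * a + j < n := by
        rcases f_side a hfa with h1 | h1
        · exact h1
        · exact absurd ⟨a, han, hWa, hfa, h1⟩ hexR
      obtain ⟨wa1, wa2, wa3, wa4, wa5⟩ := hWa
      refine le_trans (hobx (a + M₁ - K))
        (mono W (fun h => h ≤ K ∧ a + M₁ - K ≤ K - h ∧ K - h ≤ M₁ - (a + M₁ - K)) ?_ ?_)
      · intro h hq
        obtain ⟨q1, q2, q3⟩ := hq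
        exact ⟨by omega, by omega, by omega, by omega, by omega⟩
      · intro h hhn hWh hnq
        obtain ⟨w1, w2, w3, w4, w5⟩ := hWh
        have hcases : h < a ∨ n - j - a < h := by
          by_contra hc
          push Not at hc
          exact hnq ⟨by omega, by omega, by omega⟩
        rcases hcases with hlt | hgt
        · by_contra hc
          push Not at hc
          exact hmin h hlt ⟨hhn, ⟨w1, w2, w3, w4, w5⟩, hc⟩
        · by_contra hc
          push Not at hc
          rcases f_side h hc with h1 | h1
          · omega
          · exact hexR ⟨h, hhn, ⟨w1, w2, w3, w4, w5⟩, hc, h1⟩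
  · by_cases hexR : ∃ h, h < n + 1 ∧ W h ∧ f h < 0 ∧ n < 2 * h
    · -- negatives only on the right: b := the largest negative element of W; compare with the h-window [n-b, b]
      obtain ⟨hR, hRn, hWR, hfR, hsR⟩ := hexR
      have hspec : W (Nat.findGreatest (fun h => W h ∧ f h < 0) n) ∧
          f (Nat.findGreatest (fun h => W h ∧ f h < 0) n) < 0 :=
        Nat.findGreatest_spec (P := fun h => W h ∧ f h < 0) (by omega : hR ≤ n) ⟨hWR, hfR⟩
      have hbn : Nat.findGreatest (fun h => W h ∧ f h < 0) n ≤ n := Nat.findGreatest_le n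
      have hmax : ∀ h, Nat.findGreatest (fun h => W h ∧ f h < 0) n < h → h ≤ n → ¬ (W h ∧ f h < 0) :=
        fun h h1 h2 => Nat.findGreatest_is_greatest h1 h2
      set b := Nat.findGreatest (fun h => W h ∧ f h < 0) n with hb
      have hsb : n < 2 * b := by
        rcases f_side b hspec.2 with h1 | h1
        · exact absurd ⟨b, by omega, hspec.1, hspec.2, h1⟩ hexL
        · exact h1
      obtain ⟨wb1, wb2, wb3, wb4, wb5⟩ := hspec.1
      refine le_trans (hobh (n - b)) (mono W (fun h => n - b ≤ h ∧ h ≤ n - (n - b) ∧ h ≤ K) ?_ ?_)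
      · intro h hq
        obtain ⟨q1, q2, q3⟩ := hq
        exact ⟨by omega, by omega, by omega, by omega, by omega⟩
      · intro h hhn hWh hnq
        obtain ⟨w1, w2, w3, w4, w5⟩ := hWh
        have hcases : h < n - b ∨ b < h := by
          by_contra hc
          push Not at hc
          exact hnq ⟨by omega, by omega, by omega⟩
        rcases hcases with hlt | hgt
        · by_contra hc
          push Not at hc
          rcases f_side h hc with h1 | h1
          · exact hexL ⟨h, hhn, ⟨w1, w2, w3, w4, w5⟩, hc, h1⟩
          · omega
        · by_contra hc
          push Not at hc
          exact hmax h hgt (by omega) ⟨⟨w1, w2, w3, w4, w5⟩, hc⟩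
    · -- no negative W-terms at all
      apply sum_nonneg
      intro h hh
      by_cases hw : W h
      · rw [if_pos hw]
        apply mul_nonneg (hPnn h)
        by_contra hc
        push Not at hc
        rcases f_side h hc with h1 | h1
        · exact hexL ⟨h, mem_range.mp hh, hw, hc, h1⟩
        · exact hexR ⟨h, mem_range.mp hh, hw, hc, h1⟩
      · rw [if_neg hw]

end UZero

end Summit.CriticalPhenomena.PercolationContinuityZ3.Theorems
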